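import Literature.IUT.LogVolume.IsometryEmbeddingOrder
import Literature.IUT.LogVolume.TensorPacketFactorDifferentBound
import HarnessLib

/-!
# The MONOMIAL BOX of a tensor packet: a lattice `R_I ⊆ Box ⊆ (R_I)^∼` stable under EVERY factorwise isometry, and equal to `(R_I)^∼`
# as soon as the monomial norms are incongruent mod `p^ℤ` — wild slots allowed

abc-iut cell, seat abc-iut-E-t58 (gen 5; rung LADDER-ABC:A2.RESCUE.J, R-J row Y-29b, the «MIXED slot fields» parenthesis of the word of
record).  PROOF-ONLY classical local algebra over the cell's REAL packet definitions (`TensorPacketRing.lean`: `PacketAlgebra p k = V =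
⊗_{ℚ_p} k_i`, `normalizedPacket = (R_I)^∼`, [IUTchIV] Prop. 1.1 p. 9) and Mathlib's tensor basis `Basis.piTensorProduct`; no definition,
no `Prop` fact, no `sorry`.  Sequel of this seat's box lineage (p461950, p464614, p471568: at a tame pure radical packet `K ⊗ K` the
normalised packet IS a valuation box, hence stable) — now for ANY finite family of slot fields `k_i`, without computing `(R_I)^∼`.
Fix `ℚ_p`-bases `b^{(i)}` of the slots, the tensor basis `B_J = ⊗_i b^{(i)}_{J_i}` (`J ∈ ∏_i κ_i`) and write `z = Σ_J z_J B_J`; the MONOMIAL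
BOX of `b` is the `ℤ_p`-lattice `{z : ‖z_J‖·∏_i ‖b^{(i)}_{J_i}‖ ≤ 1 ∀J}` (spelled out in every statement; no definition is introduced).

* §0 `norm_smul_le_norm_sum_of_incongruent` — if the norms `‖v_m‖` of a finite family are pairwise INCONGRUENT mod `p^ℤ = |ℚ_p^×|`,
  then `‖c_m v_m‖ ≤ ‖Σ_m c_m v_m‖` for `ℚ_p`-coefficients (non-zero terms have distinct norms; Mathlib `norm_sum_eq_sup'_of_pairwise_ne`).
* §1 `smul_purePacket_mem_normalizedPacket` — `c·⊗x_i ∈ (R_I)^∼` as soon as `‖c‖·∏‖x_i‖ ≤ 1` (campaign-S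
  `exists_eq_ppow_mul_of_prod_norm_le`); hence **`mem_normalizedPacket_of_box`: Box ⊆ (R_I)^∼** for EVERY family of bases.
* §2 **`box_map_of_dominated`** — if each `b^{(i)}` is norm-DOMINATED (`‖x_m b_m‖ ≤ ‖x‖`: Weil's orthogonal bases, which exist at every
  slot — E-t42's `TameDualPair.exists_dominated_basis`) then EVERY factorwise norm-non-increasing `⊗_i f_i` maps Box into Box (the matrix
  of `⊗f_i` in the basis `B` is the Kronecker product of the slot matrices, `repr_map_apply`).  No hypothesis on the fields: Box is a
  STABLE lattice between `R_I` and `(R_I)^∼` at every packet, so factorwise-isometric MOVERS of `(R_I)^∼` live in `(R_I)^∼ / Box`.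
* §3 **`box_of_mem_normalizedPacket_of_incongruent`** — if the monomial norms `∏_i ‖b^{(i)}_{J_i}‖` are pairwise incongruent mod `p^ℤ`
  then `(R_I)^∼ ⊆ Box` (evaluate at `⊗σ_i : V → ℚ̄_p` for embeddings `σ_i : k_i → ℚ̄_p` — campaign `exists_algHom_of_algHom`,
  `norm_map_algHom`, `PadicAlgCl.norm_le_one_iff_isIntegral` — and read off the coefficients by §0); with §1–§2
  **`congr_image_normalizedPacket_eq_of_incongruent`: `(⊗g_i)((R_I)^∼) = (R_I)^∼` for all factorwise `ℚ_p`-linear isometries.**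
* INSTANCE (sequel `PacketMonomialBoxCoprime.lean`): slots TOTALLY RAMIFIED of PAIRWISE COPRIME degrees have power bases with
  incongruent monomial norms, so `(R_I)^∼` = Box is STABLE under every factorwise isometry with NO tameness hypothesis — e.g. the MIXED
  packets `ℚ_3(∛3) ⊗ ℚ_3(√3)` (WILD ⊗ tame-ramified), `ℚ_2(√2) ⊗ ℚ_2(∛2)` are stable although their first slots carry two-slot movers of
  record at `K ⊗ K` (p454126, p457999): for MIXED slot fields «some slot bad ∧ another slot ramified» is NOT the mover criterion.

Honest scope: §3 needs `[k_i:ℚ_p]` distinct norm classes per slot (total ramification) and incongruence ACROSS slots; equal or non-coprime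
indices (the IUT equal-slot shape `K_w ⊗ ⋯ ⊗ K_w`) are NOT decided here — there Box ⊊ (R_I)^∼ in general and both behaviours occur (the
cell's movers of record vs. the stable classes of E-t42 / E-t47 / E-cx-2).  §1–§2 hold at EVERY packet.  Nothing here is disputed
mathematics; the [IUTchIV] locators record the cell's typing of the packet notation.
[cite: Mochizuki2012, IUTchIV Prop. 1.1 p. 9] [cite: WeilBNT1967, Ch. II §1, Prop. 3] [cite: NeukirchANT1999, Ch. II (4.8)]
-/

noncomputable section

open Module
open scoped Pointwise

namespace Literature.IUT.LogVolume

namespace MonomialBox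

/-! ## §0 Ultrametric bookkeeping: incongruent norms -/

section Ultrametric

variable {p : ℕ} [hp : Fact p.Prime]

/-- Real arithmetic: `p^{−v₁}·A = p^{−v₂}·B ⟹ A = p^{v₁−v₂}·B`. [cite: NeukirchANT1999, Ch. II (4.8)] -/
theorem eq_zpow_mul_of_zpow_mul_eq {A B : ℝ} {v₁ v₂ : ℤ} (h : (p : ℝ) ^ (-v₁) * A = (p : ℝ) ^ (-v₂) * B) :
    A = (p : ℝ) ^ (v₁ - v₂) * B := by
  have hp0 : (p : ℝ) ≠ 0 := by exact_mod_cast hp.out.ne_zero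
  calc A = (p : ℝ) ^ v₁ * ((p : ℝ) ^ (-v₁) * A) := by
        rw [← mul_assoc, ← zpow_add₀ hp0, add_neg_cancel, zpow_zero, one_mul]
    _ = (p : ℝ) ^ v₁ * ((p : ℝ) ^ (-v₂) * B) := by rw [h]
    _ = (p : ℝ) ^ (v₁ - v₂) * B := by rw [← mul_assoc, ← zpow_add₀ hp0, sub_eq_add_neg]

variable {M : Type*} [NormedAddCommGroup M] [NormedSpace ℚ_[p] M]

/-- If the norms `‖v_m‖` are pairwise incongruent mod `p^ℤ`, the NON-ZERO terms `c_m·v_m` (`c_m ∈ ℚ_p`, `‖c_m‖ ∈ p^ℤ`) have pairwise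
distinct norms. [cite: NeukirchANT1999, Ch. II (4.8)] -/
theorem norm_smul_ne_of_incongruent {ι : Type*} (v : ι → M)
    (hv : ∀ m m', m ≠ m' → ∀ n : ℤ, ‖v m‖ ≠ (p : ℝ) ^ n * ‖v m'‖) (c : ι → ℚ_[p]) {m m' : ι} (hne : m ≠ m')
    (hm : c m • v m ≠ 0) (hm' : c m' • v m' ≠ 0) : ‖c m • v m‖ ≠ ‖c m' • v m'‖ := by
  intro h
  have hc : c m ≠ 0 := fun h0 => hm (by rw [h0, zero_smul])
  have hc' : c m' ≠ 0 := fun h0 => hm' (by rw [h0, zero_smul])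
  rw [norm_smul, norm_smul, Padic.norm_eq_zpow_neg_valuation hc, Padic.norm_eq_zpow_neg_valuation hc'] at h
  exact hv m m' hne _ (eq_zpow_mul_of_zpow_mul_eq h)

variable [IsUltrametricDist M]

/-- **Each term is dominated by the sum** when the norms `‖v_m‖` are pairwise incongruent mod `p^ℤ`: `‖c_m·v_m‖ ≤ ‖Σ_{m'} c_{m'}·v_{m'}‖`
(drop the zero terms; the others have distinct norms, so the ultrametric sum has the maximal norm). [cite: WeilBNT1967, Ch. II §1, Prop. 3] -/
theorem norm_smul_le_norm_sum_of_incongruent {ι : Type*} [Fintype ι] (v : ι → M)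
    (hv : ∀ m m', m ≠ m' → ∀ n : ℤ, ‖v m‖ ≠ (p : ℝ) ^ n * ‖v m'‖) (c : ι → ℚ_[p]) (m : ι) :
    ‖c m • v m‖ ≤ ‖∑ m', c m' • v m'‖ := by
  classical
  by_cases h0 : c m • v m = 0
  · rw [h0, norm_zero]; exact norm_nonneg _
  set t : ι → M := fun m' => c m' • v m' with ht
  have hmem : m ∈ Finset.univ.filter (fun m' => t m' ≠ 0) := Finset.mem_filter.mpr ⟨Finset.mem_univ m, h0⟩
  change ‖t m‖ ≤ ‖∑ m', t m'‖
  rw [← Finset.sum_filter_ne_zero Finset.univ, IsUltrametricDist.norm_sum_eq_sup'_of_pairwise_ne ⟨m, hmem⟩]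
  · exact Finset.le_sup' (fun m' => ‖t m'‖) hmem
  · intro m₁ h₁ m₂ h₂ h12
    exact norm_smul_ne_of_incongruent v hv c h12 (Finset.mem_filter.mp (Finset.mem_coe.mp h₁)).2
      (Finset.mem_filter.mp (Finset.mem_coe.mp h₂)).2

end Ultrametric

/-! ## §1 Pure tensors of total norm `≤ 1` are integral: Box ⊆ `(R_I)^∼` -/

section Packet

variable (p : ℕ) [hp : Fact p.Prime] {I : Type} [Fintype I] [DecidableEq I]
  (k : I → Type) [∀ i, NontriviallyNormedField (k i)] [∀ i, NormedAlgebra ℚ_[p] (k i)]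
  [∀ i, IsUltrametricDist (k i)] [∀ i, ProperSpace (k i)]

/-- **`⊗x_i ∈ (R_I)^∼` whenever `∏_i ‖x_i‖ ≤ 1`** — although single slots may be non-integral: `(⊗x_i)^{∏e_i} = p^t·⊗u_i` with `t ≥ 0`
and units `u_i` (campaign-S `exists_eq_ppow_mul_of_prod_norm_le` at `n = 0`), so `⊗x_i` is integral over `R_I`.
[cite: Mochizuki2012, IUTchIV Prop. 1.1 p. 9] -/
theorem purePacket_mem_normalizedPacket_of_prod_norm_le [Nonempty I] {x : Π i, k i} (hx : ∏ i, ‖x i‖ ≤ 1) :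
    purePacket p k x ∈ normalizedPacket p k := by
  classical
  by_cases h0 : ∃ i, x i = 0
  · obtain ⟨i, hi⟩ := h0
    rw [show purePacket p k x = 0 from (PiTensorProduct.tprod ℚ_[p] (s := k)).map_coord_zero i hi]
    exact Subring.zero_mem _
  · push Not at h0
    have hx' : ∏ i, ‖x i‖ ≤ (p : ℝ) ^ (-((0 : ℤ) : ℝ)) := by simpa using hx
    obtain ⟨y, hy, hxy⟩ := exists_eq_ppow_mul_of_prod_norm_le p k h0 hx'
    rwa [hxy, ppow_zero, one_mul]

/-- **`c·⊗x_i ∈ (R_I)^∼` whenever `‖c‖·∏_i ‖x_i‖ ≤ 1`** (`c ∈ ℚ_p`; move the scalar into a slot). [cite: Mochizuki2012, IUTchIV Prop. 1.1 p. 9] -/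
theorem smul_purePacket_mem_normalizedPacket [Nonempty I] (c : ℚ_[p]) {x : Π i, k i}
    (hx : ‖c‖ * ∏ i, ‖x i‖ ≤ 1) : c • purePacket p k x ∈ normalizedPacket p k := by
  classical
  obtain ⟨i₀⟩ := ‹Nonempty I›
  rw [smul_purePacket p k i₀]
  refine purePacket_mem_normalizedPacket_of_prod_norm_le p k ?_
  have hprod : ∏ i, ‖Function.update x i₀ (c • x i₀) i‖ = ‖c‖ * ∏ i, ‖x i‖ := by
    rw [Finset.prod_eq_mul_prod_sdiff_singleton_of_mem (Finset.mem_univ i₀)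
        (fun i => ‖Function.update x i₀ (c • x i₀) i‖),
      Finset.prod_eq_mul_prod_sdiff_singleton_of_mem (Finset.mem_univ i₀) (fun i => ‖x i‖),
      Function.update_self, norm_smul, mul_assoc]
    congr 2
    refine Finset.prod_congr rfl fun i hi => ?_
    have hne : i ≠ i₀ := fun h => (Finset.mem_sdiff.mp hi).2 (Finset.mem_singleton.mpr h)
    rw [Function.update_of_ne hne]
  rwa [hprod]

variable {κ : I → Type} [∀ i, Fintype (κ i)] (b : ∀ i, Basis (κ i) ℚ_[p] (k i))

/-- **Box ⊆ `(R_I)^∼`** for EVERY family of slot bases `b^{(i)}`: if `‖z_J‖·∏_i ‖b^{(i)}_{J_i}‖ ≤ 1` for every tensor-basis coordinate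
`z_J` of `z`, then `z = Σ_J z_J·⊗_i b^{(i)}_{J_i}` is a sum of elements of the subring `(R_I)^∼`. [cite: Mochizuki2012, IUTchIV Prop. 1.1 p. 9] -/
theorem mem_normalizedPacket_of_box [Nonempty I] {z : PacketAlgebra p k}
    (hz : ∀ J : Π i, κ i, ‖(Basis.piTensorProduct b).repr z J‖ * ∏ i, ‖b i (J i)‖ ≤ 1) :
    z ∈ normalizedPacket p k := by
  classical
  rw [← (Basis.piTensorProduct b).sum_repr z]
  refine Subring.sum_mem _ fun J _ => ?_
  rw [Basis.piTensorProduct_apply, ← purePacket]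
  exact smul_purePacket_mem_normalizedPacket p k _ (hz J)

/-! ## §2 The box of DOMINATED bases is stable under every factorwise contraction -/

omit [∀ i, IsUltrametricDist (k i)] [∀ i, ProperSpace (k i)] in
/-- **The matrix of `⊗_i f_i` in the tensor basis is the Kronecker product of the slot matrices**:
`((⊗f_i) z)_J = Σ_{J'} z_{J'} · ∏_i (f_i b^{(i)}_{J'_i})_{J_i}`. [cite: Mochizuki2012, IUTchIV Prop. 1.1 p. 9] -/
theorem repr_map_apply (f : ∀ i, k i →ₗ[ℚ_[p]] k i) (z : PacketAlgebra p k) (J : Π i, κ i) :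
    (Basis.piTensorProduct b).repr (PiTensorProduct.map f z) J =
      ∑ J' : Π i, κ i, (Basis.piTensorProduct b).repr z J' * ∏ i, (b i).repr (f i (b i (J' i))) (J i) := by
  classical
  have h1 : PiTensorProduct.map f z =
      ∑ J' : Π i, κ i, (Basis.piTensorProduct b).repr z J' • PiTensorProduct.map f (Basis.piTensorProduct b J') := by
    conv_lhs => rw [← (Basis.piTensorProduct b).sum_repr z]
    rw [map_sum]
    exact Finset.sum_congr rfl fun J' _ => by rw [map_smul]
  rw [h1, map_sum, Finsupp.finsetSum_apply]
  refine Finset.sum_congr rfl fun J' _ => ?_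
  rw [map_smul, Finsupp.smul_apply, smul_eq_mul, Basis.piTensorProduct_apply, PiTensorProduct.map_tprod,
    Basis.piTensorProduct_repr_tprod_apply]

omit [∀ i, IsUltrametricDist (k i)] [∀ i, ProperSpace (k i)] in
/-- **Box is STABLE under factorwise contractions.**  If every slot basis is norm-DOMINATED (`‖x_m·b_m‖ ≤ ‖x‖` — an orthogonal basis in
Weil's sense) and every `f_i` is norm-non-increasing, then `⊗_i f_i` maps the box `{z : ‖z_J‖·∏_i‖b^{(i)}_{J_i}‖ ≤ 1 ∀J}` into itself: by
`repr_map_apply` and the ultrametric inequality it suffices that `‖z_{J'}‖·∏_i ‖(f_i b_{J'_i})_{J_i}‖·‖b_{J_i}‖ ≤ ‖z_{J'}‖·∏_i ‖b_{J'_i}‖`,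
and domination gives `‖(f_i b_{J'_i})_{J_i}‖·‖b_{J_i}‖ ≤ ‖f_i b_{J'_i}‖ ≤ ‖b_{J'_i}‖`.  NO hypothesis on the slot fields.
[cite: WeilBNT1967, Ch. II §1, Prop. 3] -/
theorem box_map_of_dominated (hdom : ∀ i (x : k i) (m : κ i), ‖(b i).repr x m • b i m‖ ≤ ‖x‖)
    (f : ∀ i, k i →ₗ[ℚ_[p]] k i) (hf : ∀ i x, ‖f i x‖ ≤ ‖x‖) {z : PacketAlgebra p k}
    (hz : ∀ J : Π i, κ i, ‖(Basis.piTensorProduct b).repr z J‖ * ∏ i, ‖b i (J i)‖ ≤ 1) (J : Π i, κ i) :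
    ‖(Basis.piTensorProduct b).repr (PiTensorProduct.map f z) J‖ * ∏ i, ‖b i (J i)‖ ≤ 1 := by
  classical
  have hpos : 0 < ∏ i, ‖b i (J i)‖ := Finset.prod_pos fun i _ => norm_pos_iff.mpr ((b i).ne_zero (J i))
  rw [repr_map_apply, ← le_div_iff₀ hpos]
  refine IsUltrametricDist.norm_sum_le_of_forall_le_of_nonneg (div_nonneg zero_le_one hpos.le) fun J' _ => ?_
  rw [le_div_iff₀ hpos, norm_mul, norm_prod, mul_assoc, ← Finset.prod_mul_distrib]
  have key : ∀ i, ‖(b i).repr (f i (b i (J' i))) (J i)‖ * ‖b i (J i)‖ ≤ ‖b i (J' i)‖ := fun i => by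
    rw [← norm_smul]
    exact (hdom i _ _).trans (hf i _)
  calc ‖(Basis.piTensorProduct b).repr z J'‖ * ∏ i, ‖(b i).repr (f i (b i (J' i))) (J i)‖ * ‖b i (J i)‖
      ≤ ‖(Basis.piTensorProduct b).repr z J'‖ * ∏ i, ‖b i (J' i)‖ :=
        mul_le_mul_of_nonneg_left (Finset.prod_le_prod (fun i _ => by positivity) fun i _ => key i) (norm_nonneg _)
    _ ≤ 1 := hz J'

/-! ## §3 Incongruent monomial norms: `(R_I)^∼` ⊆ Box, hence `(R_I)^∼` = Box is stable -/

omit [∀ i, IsUltrametricDist (k i)] [∀ i, ProperSpace (k i)] [∀ i, Fintype (κ i)] in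
/-- Incongruence of the monomial norms `∏_i ‖b^{(i)}_{J_i}‖` mod `p^ℤ` implies incongruence of the norms within each slot (freeze the
other coordinates). [cite: WeilBNT1967, Ch. II §1, Prop. 3] -/
theorem slot_incongruent_of_incongruent
    (hinc : ∀ J J' : Π i, κ i, J ≠ J' → ∀ n : ℤ, ∏ i, ‖b i (J i)‖ ≠ (p : ℝ) ^ n * ∏ i, ‖b i (J' i)‖)
    (i : I) (m m' : κ i) (hm : m ≠ m') (n : ℤ) : ‖b i m‖ ≠ (p : ℝ) ^ n * ‖b i m'‖ := by
  classical
  have J₀ : Π j, κ j := fun j => Classical.choice (b j).index_nonempty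
  intro h
  refine hinc (Function.update J₀ i m) (Function.update J₀ i m') ?_ n ?_
  · intro hJ
    exact hm (by simpa using congr_fun hJ i)
  · rw [Finset.prod_eq_mul_prod_sdiff_singleton_of_mem (Finset.mem_univ i) (fun j => ‖b j (Function.update J₀ i m j)‖),
      Finset.prod_eq_mul_prod_sdiff_singleton_of_mem (Finset.mem_univ i) (fun j => ‖b j (Function.update J₀ i m' j)‖),
      Function.update_self, Function.update_self, h, mul_assoc]
    congr 2
    refine Finset.prod_congr rfl fun j hj => ?_
    have hne : j ≠ i := fun h => (Finset.mem_sdiff.mp hj).2 (Finset.mem_singleton.mpr h)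
    rw [Function.update_of_ne hne, Function.update_of_ne hne]

omit [∀ i, ProperSpace (k i)] in
/-- … hence every slot basis is norm-DOMINATED: `‖x_m·b_m‖ ≤ ‖x‖` (`norm_smul_le_norm_sum_of_incongruent` in `k_i`).
[cite: WeilBNT1967, Ch. II §1, Prop. 3] -/
theorem dominated_of_incongruent
    (hinc : ∀ J J' : Π i, κ i, J ≠ J' → ∀ n : ℤ, ∏ i, ‖b i (J i)‖ ≠ (p : ℝ) ^ n * ∏ i, ‖b i (J' i)‖)
    (i : I) (x : k i) (m : κ i) : ‖(b i).repr x m • b i m‖ ≤ ‖x‖ := by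
  have h := norm_smul_le_norm_sum_of_incongruent (p := p) (fun m' => b i m')
    (fun m₁ m₂ hne n => slot_incongruent_of_incongruent p k b hinc i m₁ m₂ hne n) (fun m' => (b i).repr x m') m
  rwa [(b i).sum_repr x] at h

/-- **Incongruent monomial norms ⟹ `(R_I)^∼` ⊆ Box.**  With embeddings `σ_i : k_i → ℚ̄_p` and `Φ := ⊗σ_i : V → ℚ̄_p` (`⊗x_i ↦ ∏ σ_i(x_i)`):
for `z ∈ (R_I)^∼`, `Φ z` is `ℤ_p`-integral, so `‖Φ z‖ ≤ 1`; and `Φ z = Σ_J z_J·∏_i σ_i(b^{(i)}_{J_i})` with `‖∏_i σ_i(b_{J_i})‖ = ∏_i ‖b_{J_i}‖`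
(embeddings are isometries) pairwise incongruent, so §0 gives `‖z_J‖·∏_i‖b_{J_i}‖ ≤ ‖Φ z‖ ≤ 1`.
[cite: Mochizuki2012, IUTchIV Prop. 1.1 p. 9] [cite: NeukirchANT1999, Ch. II (4.8)] -/
theorem box_of_mem_normalizedPacket_of_incongruent [Nonempty I]
    (hinc : ∀ J J' : Π i, κ i, J ≠ J' → ∀ n : ℤ, ∏ i, ‖b i (J i)‖ ≠ (p : ℝ) ^ n * ∏ i, ‖b i (J' i)‖)
    {z : PacketAlgebra p k} (hz : z ∈ normalizedPacket p k) (J : Π i, κ i) :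
    ‖(Basis.piTensorProduct b).repr z J‖ * ∏ i, ‖b i (J i)‖ ≤ 1 := by
  classical
  have σ : ∀ i, k i →ₐ[ℚ_[p]] PadicAlgCl p := fun i => Classical.choice EmbeddingOrder.nonempty_algHom_padicAlgCl
  obtain ⟨Φ, hΦ⟩ := exists_algHom_of_algHom p k σ
  -- `Φ z` is integral over `ℤ_p`, hence of norm `≤ 1`
  have hint : ‖Φ z‖ ≤ 1 :=
    (Literature.NumberTheory.GaloisRepresentations.PadicAlgCl.norm_le_one_iff_isIntegral _).mpr
      ((isIntegral_of_mem_normalizedPacket p k hz).map (Φ.restrictScalars ℤ_[p]))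
  -- the expansion of `Φ z` along the tensor basis
  set v : (Π i, κ i) → PadicAlgCl p := fun J' => ∏ i, σ i (b i (J' i)) with hv
  have hnorm : ∀ J', ‖v J'‖ = ∏ i, ‖b i (J' i)‖ := fun J' => by
    rw [hv, norm_prod]
    exact Finset.prod_congr rfl fun i _ => norm_map_algHom (σ i) _
  have hexp : Φ z = ∑ J', (Basis.piTensorProduct b).repr z J' • v J' := by
    conv_lhs => rw [← (Basis.piTensorProduct b).sum_repr z]
    rw [map_sum]
    refine Finset.sum_congr rfl fun J' _ => ?_
    rw [map_smul, Basis.piTensorProduct_apply, ← purePacket, hΦ]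
  have hvinc : ∀ J₁ J₂, J₁ ≠ J₂ → ∀ n : ℤ, ‖v J₁‖ ≠ (p : ℝ) ^ n * ‖v J₂‖ := fun J₁ J₂ hne n => by
    rw [hnorm, hnorm]; exact hinc J₁ J₂ hne n
  have hle := norm_smul_le_norm_sum_of_incongruent (p := p) v hvinc (fun J' => (Basis.piTensorProduct b).repr z J') J
  rw [← hexp, norm_smul, hnorm] at hle
  exact hle.trans hint

/-- **`(R_I)^∼` = Box** at incongruent monomial norms: membership in the normalised packet is the coordinate condition
`‖z_J‖·∏_i ‖b^{(i)}_{J_i}‖ ≤ 1 ∀J` (§1 + `box_of_mem_normalizedPacket_of_incongruent`). [cite: Mochizuki2012, IUTchIV Prop. 1.1 p. 9] -/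
theorem mem_normalizedPacket_iff_box_of_incongruent [Nonempty I]
    (hinc : ∀ J J' : Π i, κ i, J ≠ J' → ∀ n : ℤ, ∏ i, ‖b i (J i)‖ ≠ (p : ℝ) ^ n * ∏ i, ‖b i (J' i)‖)
    (z : PacketAlgebra p k) :
    z ∈ normalizedPacket p k ↔ ∀ J : Π i, κ i, ‖(Basis.piTensorProduct b).repr z J‖ * ∏ i, ‖b i (J i)‖ ≤ 1 :=
  ⟨fun hz => box_of_mem_normalizedPacket_of_incongruent p k b hinc hz, mem_normalizedPacket_of_box p k b⟩

/-- **Incongruent monomial norms ⟹ `(⊗_i g_i)((R_I)^∼) = (R_I)^∼` for ALL factorwise `ℚ_p`-linear isometries** (any slot fields with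
such bases, wild or not): `(R_I)^∼` = Box (§3), the slot bases are dominated (`dominated_of_incongruent`), and Box is mapped into itself
by `⊗g_i` and by `⊗g_i⁻¹` (§2). [cite: Mochizuki2012, IUTchIV Prop. 1.1 p. 9] [cite: WeilBNT1967, Ch. II §1, Prop. 3] -/
theorem congr_image_normalizedPacket_eq_of_incongruent [Nonempty I]
    (hinc : ∀ J J' : Π i, κ i, J ≠ J' → ∀ n : ℤ, ∏ i, ‖b i (J i)‖ ≠ (p : ℝ) ^ n * ∏ i, ‖b i (J' i)‖)
    (g : ∀ i, k i ≃ₗ[ℚ_[p]] k i) (hg : ∀ i x, ‖g i x‖ = ‖x‖) :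
    (PiTensorProduct.congr g : PacketAlgebra p k ≃ₗ[ℚ_[p]] PacketAlgebra p k) ''
        (normalizedPacket p k : Set (PacketAlgebra p k)) = normalizedPacket p k := by
  have hdom := dominated_of_incongruent p k b hinc
  have hg' : ∀ i x, ‖(g i).symm x‖ ≤ ‖x‖ := fun i x => by
    conv_rhs => rw [← (g i).apply_symm_apply x, hg i]
  have h1 : ∀ z, (PiTensorProduct.congr g : PacketAlgebra p k ≃ₗ[ℚ_[p]] PacketAlgebra p k) z =
      PiTensorProduct.map (fun i => (g i : k i →ₗ[ℚ_[p]] k i)) z := fun z => rfl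
  have h2 : ∀ z, (PiTensorProduct.congr g : PacketAlgebra p k ≃ₗ[ℚ_[p]] PacketAlgebra p k).symm z =
      PiTensorProduct.map (fun i => ((g i).symm : k i →ₗ[ℚ_[p]] k i)) z := fun z => rfl
  apply Set.Subset.antisymm
  · rintro _ ⟨z, hz, rfl⟩
    rw [h1]
    exact mem_normalizedPacket_of_box p k b (box_map_of_dominated p k b hdom _ (fun i x => (hg i x).le)
      (box_of_mem_normalizedPacket_of_incongruent p k b hinc hz))
  · intro z hz
    refine ⟨(PiTensorProduct.congr g : PacketAlgebra p k ≃ₗ[ℚ_[p]] PacketAlgebra p k).symm z, ?_,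
      LinearEquiv.apply_symm_apply _ _⟩
    rw [h2]
    exact mem_normalizedPacket_of_box p k b (box_map_of_dominated p k b hdom _ hg'
      (box_of_mem_normalizedPacket_of_incongruent p k b hinc hz))

end Packet

end MonomialBox

end Literature.IUT.LogVolume

end
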